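import Mathlib.Analysis.SpecialFunctions.Trigonometric.Sinc
import Mathlib.Analysis.SpecialFunctions.Integrals.Basic
import Mathlib.Analysis.SpecialFunctions.ImproperIntegrals
import Mathlib.MeasureTheory.Integral.IntegralEqImproper
import Mathlib.MeasureTheory.Measure.Haar.NormedSpace
import HarnessLib

/-!
# The Fejér kernel on `ℝ` (toolkit for the Wiener–Ikehara theorem)

Topic `Literature/NumberTheory/LFunctions`. First of four files proving the Wiener–Ikehara
Tauberian theorem `Literature.NumberTheory.LFunctions.WienerIkehara` (Montgomery–Vaughan 2007, Cor. 8.8) via the classical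
Ikehara–Bochner–Landau argument (Fejér kernel + monotonicity). This file collects the elementary
facts about the Fejér kernel

  `K_λ(x) = 2 λ sinc(λ x)² = 2 sin²(λ x) / (λ x²)`   (`λ > 0`),

written inline as `2 * l * Real.sinc (l * x) ^ 2` (no new definitions): non-negativity, the bounds
`K_λ ≤ 2λ`, `K_λ(x) ≤ 2/(λ x²)`, `K_λ(x) (1 + x²) ≤ 2λ + 2/λ`, continuity, integrability, positivity
of `∫ K_λ`, the scalings `∫_ℝ K_λ = ∫_ℝ K_1`, `∫_{-δ}^{δ} K_λ = ∫_{-λδ}^{λδ} K_1`, the concentration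
`∫_{-δ}^{δ} K_λ → ∫_ℝ K_1` as `λ → ∞`, and the Fourier identity (Fejér kernel = transform of the
triangle function)

  `∫_{-2λ}^{2λ} (1 − |t|/(2λ)) e^{i t x} dt = K_λ(x)`.

## References

* H. L. Montgomery, R. C. Vaughan, *Multiplicative Number Theory I. Classical Theory*, Cambridge
  Stud. Adv. Math. 97, CUP 2007, §8.3 (proof of Lemma 8.5 uses the Fejér kernel `Δ_T` and
  `\hat Δ_T(t) = 0` for `|t| ≥ T`), §5.1 eq. (5.15)–(5.17), Appendix D.
* K. Chandrasekharan, *Introduction to Analytic Number Theory*, Grundlehren 148, Springer 1968,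
  Ch. XI §2 (the classical proof of Wiener–Ikehara with the kernel `sin²(λx)/(λx²)`).
-/

noncomputable section

open Real MeasureTheory Filter Set intervalIntegral
open scoped Topology

namespace Literature.NumberTheory.LFunctions.WienerIkehara

/-! ## Pointwise bounds -/

/-- `K_λ(x) = 2λ sinc(λx)² ≥ 0` for `λ ≥ 0`. [folklore] -/
theorem fejer_nonneg {l : ℝ} (hl : 0 ≤ l) (x : ℝ) : 0 ≤ 2 * l * sinc (l * x) ^ 2 := by
  positivity

/-- `K_λ(x) ≤ 2λ` for `λ ≥ 0` (since `|sinc| ≤ 1`). [folklore] -/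
theorem fejer_le {l : ℝ} (hl : 0 ≤ l) (x : ℝ) : 2 * l * sinc (l * x) ^ 2 ≤ 2 * l := by
  have h1 : sinc (l * x) ^ 2 ≤ 1 := by
    have := abs_sinc_le_one (l * x)
    rw [← sq_abs]
    nlinarith [abs_nonneg (sinc (l * x))]
  nlinarith

/-- `K_λ(x) ≤ 2 / (λ x²)` for `λ > 0`, `x ≠ 0` (since `sinc(y)² = sin² y / y² ≤ 1/y²`).
[folklore] -/
theorem fejer_le_div {l : ℝ} (hl : 0 < l) {x : ℝ} (hx : x ≠ 0) :
    2 * l * sinc (l * x) ^ 2 ≤ 2 / (l * x ^ 2) := by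
  have hlx : l * x ≠ 0 := mul_ne_zero hl.ne' hx
  rw [sinc_of_ne_zero hlx, div_pow]
  have hs : sin (l * x) ^ 2 ≤ 1 := sin_sq_le_one (l * x)
  have hlx2 : 0 < (l * x) ^ 2 := by positivity
  calc 2 * l * (sin (l * x) ^ 2 / (l * x) ^ 2) ≤ 2 * l * (1 / (l * x) ^ 2) := by
        gcongr
    _ = 2 / (l * x ^ 2) := by field_simp

/-- `K_λ(x) (1 + x²) ≤ 2λ + 2/λ` for `λ > 0`: the two bounds `K_λ ≤ 2λ`, `K_λ x² ≤ 2/λ` added.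
[folklore] -/
theorem fejer_mul_one_add_sq_le {l : ℝ} (hl : 0 < l) (x : ℝ) :
    2 * l * sinc (l * x) ^ 2 * (1 + x ^ 2) ≤ 2 * l + 2 / l := by
  have h1 := fejer_le hl.le x
  rcases eq_or_ne x 0 with rfl | hx
  · have : 0 < 2 / l := by positivity
    nlinarith
  · have h2 := fejer_le_div hl hx
    have hx2 : 0 < x ^ 2 := by positivity
    have h3 : 2 * l * sinc (l * x) ^ 2 * x ^ 2 ≤ 2 / l := by
      calc 2 * l * sinc (l * x) ^ 2 * x ^ 2 ≤ 2 / (l * x ^ 2) * x ^ 2 := by gcongr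
        _ = 2 / l := by field_simp
    nlinarith

/-- `K_λ(x) ≤ (2λ + 2/λ) (1 + x²)⁻¹` for `λ > 0`. [folklore] -/
theorem fejer_le_inv_one_add_sq {l : ℝ} (hl : 0 < l) (x : ℝ) :
    2 * l * sinc (l * x) ^ 2 ≤ (2 * l + 2 / l) * (1 + x ^ 2)⁻¹ := by
  have hx : 0 < 1 + x ^ 2 := by positivity
  rw [← div_eq_mul_inv, le_div_iff₀ hx]
  exact fejer_mul_one_add_sq_le hl x

/-! ## Continuity, integrability, positivity -/

/-- `x ↦ K_λ(x)` is continuous. [folklore] -/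
theorem continuous_fejer (l : ℝ) : Continuous fun x : ℝ => 2 * l * sinc (l * x) ^ 2 := by
  fun_prop

/-- `K_λ` is integrable on `ℝ` for `λ > 0`. [folklore] -/
theorem integrable_fejer {l : ℝ} (hl : 0 < l) :
    Integrable fun x : ℝ => 2 * l * sinc (l * x) ^ 2 := by
  refine Integrable.mono' (integrable_inv_one_add_sq.const_mul (2 * l + 2 / l))
    (continuous_fejer l).aestronglyMeasurable (Eventually.of_forall fun x => ?_)
  rw [Real.norm_eq_abs, abs_of_nonneg (fejer_nonneg hl.le x)]
  exact fejer_le_inv_one_add_sq hl x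

/-- `K_λ` is integrable on every interval. [folklore] -/
theorem intervalIntegrable_fejer (l a b : ℝ) :
    IntervalIntegrable (fun x : ℝ => 2 * l * sinc (l * x) ^ 2) volume a b :=
  (continuous_fejer l).intervalIntegrable a b

/-- `∫_ℝ K_λ > 0` for `λ > 0`. [folklore] -/
theorem integral_fejer_pos {l : ℝ} (hl : 0 < l) : 0 < ∫ x : ℝ, 2 * l * sinc (l * x) ^ 2 := by
  refine integral_pos_of_integrable_nonneg_nonzero (x := 0) (continuous_fejer l)
    (integrable_fejer hl) (fun x => fejer_nonneg hl.le x) ?_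
  simp [hl.ne']

/-- `∫_{-δ}^{δ} K_λ > 0` for `λ > 0`, `δ > 0`. [folklore] -/
theorem intervalIntegral_fejer_pos {l δ : ℝ} (hl : 0 < l) (hδ : 0 < δ) :
    0 < ∫ x in (-δ)..δ, 2 * l * sinc (l * x) ^ 2 := by
  have h := intervalIntegral.integral_lt_integral_of_continuousOn_of_le_of_exists_lt
    (f := fun _ => (0 : ℝ)) (g := fun x : ℝ => 2 * l * sinc (l * x) ^ 2) (a := -δ) (b := δ)
    (by linarith) continuousOn_const (continuous_fejer l).continuousOn
    (fun x _ => fejer_nonneg hl.le x) ⟨0, ⟨by linarith, hδ.le⟩, by simp [hl]⟩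
  simpa using h

/-! ## Scaling and concentration -/

/-- `∫_ℝ K_λ = ∫_ℝ K_1 (= ∫ 2 sinc²)` for `λ > 0`. [folklore] -/
theorem integral_fejer_eq {l : ℝ} (hl : 0 < l) :
    ∫ x : ℝ, 2 * l * sinc (l * x) ^ 2 = ∫ x : ℝ, 2 * sinc x ^ 2 := by
  have h := Measure.integral_comp_mul_left (fun y : ℝ => 2 * l * sinc y ^ 2) l
  rw [h, abs_of_pos (inv_pos.mpr hl), smul_eq_mul, ← MeasureTheory.integral_const_mul]
  congr 1
  ext x
  field_simp

/-- `∫_{-δ}^{δ} K_λ = ∫_{-λδ}^{λδ} K_1` for `λ > 0`. [folklore] -/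
theorem intervalIntegral_fejer_eq {l : ℝ} (hl : 0 < l) (δ : ℝ) :
    ∫ x in (-δ)..δ, 2 * l * sinc (l * x) ^ 2 = ∫ x in (-(l * δ))..(l * δ), 2 * sinc x ^ 2 := by
  have h := intervalIntegral.integral_comp_mul_left (fun y : ℝ => 2 * l * sinc y ^ 2)
    (a := -δ) (b := δ) hl.ne'
  rw [h, mul_neg, smul_eq_mul, ← intervalIntegral.integral_const_mul]
  congr 1
  ext x
  field_simp

/-- Concentration: for fixed `δ > 0`, `∫_{-δ}^{δ} K_λ → ∫_ℝ K_1` as `λ → ∞`. [folklore] -/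
theorem tendsto_intervalIntegral_fejer {δ : ℝ} (hδ : 0 < δ) :
    Tendsto (fun l : ℝ => ∫ x in (-δ)..δ, 2 * l * sinc (l * x) ^ 2) atTop
      (𝓝 (∫ x : ℝ, 2 * sinc x ^ 2)) := by
  have h1 : Integrable fun x : ℝ => 2 * sinc x ^ 2 := by
    simpa using integrable_fejer one_pos
  have h2 : Tendsto (fun l : ℝ => ∫ x in (-(l * δ))..(l * δ), 2 * sinc x ^ 2) atTop
      (𝓝 (∫ x : ℝ, 2 * sinc x ^ 2)) := by
    refine intervalIntegral_tendsto_integral h1 ?_ ?_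
    · exact tendsto_neg_atTop_atBot.comp (tendsto_id.atTop_mul_const hδ)
    · exact tendsto_id.atTop_mul_const hδ
  refine h2.congr' ?_
  filter_upwards [eventually_gt_atTop 0] with l hl
  exact (intervalIntegral_fejer_eq hl δ).symm

/-- `K_λ` is even. [folklore] -/
theorem fejer_neg (l x : ℝ) : 2 * l * sinc (l * -x) ^ 2 = 2 * l * sinc (l * x) ^ 2 := by
  rw [mul_neg, sinc_neg]

/-- `∫_{u > 0} K_λ(y − u) du = ∫_{v < y} K_λ(v) dv → ∫_ℝ K_1` as `y → ∞` (`λ > 0`). [folklore] -/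
theorem tendsto_setIntegral_Ioi_fejer_sub {l : ℝ} (hl : 0 < l) :
    Tendsto (fun y : ℝ => ∫ u in Ioi (0 : ℝ), 2 * l * sinc (l * (y - u)) ^ 2) atTop
      (𝓝 (∫ x : ℝ, 2 * sinc x ^ 2)) := by
  have h1 : ∀ y : ℝ, ∫ u in Ioi (0 : ℝ), 2 * l * sinc (l * (y - u)) ^ 2
      = ∫ v in Iio y, 2 * l * sinc (l * v) ^ 2 := by
    intro y
    rw [← MeasureTheory.integral_indicator measurableSet_Ioi,
      ← MeasureTheory.integral_indicator measurableSet_Iio,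
      ← integral_sub_left_eq_self _ volume y]
    congr 1
    ext u
    simp only [indicator, mem_Ioi, mem_Iio, sub_pos, sub_sub_cancel]
  simp_rw [h1]
  rw [← integral_fejer_eq hl]
  exact (aecover_Iio tendsto_id).integral_tendsto_of_countably_generated (integrable_fejer hl)

/-! ## The Fourier identity -/

/-- Real form on the half interval: for `x ≠ 0`, `λ > 0`,
`∫_0^{2λ} (1 − t/(2λ)) cos(t x) dt = sin²(λ x)/(λ x²) … = λ sinc(λx)²`, i.e. twice it is `K_λ(x)`.
[folklore] -/
theorem integral_triangle_mul_cos {l : ℝ} (hl : 0 < l) (x : ℝ) :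
    ∫ t in (0 : ℝ)..(2 * l), (1 - t / (2 * l)) * cos (t * x) = l * sinc (l * x) ^ 2 := by
  rcases eq_or_ne x 0 with rfl | hx
  · simp only [mul_zero, cos_zero, mul_one, sinc_zero, one_pow]
    have hderiv : ∀ t ∈ uIcc (0 : ℝ) (2 * l),
        HasDerivAt (fun t : ℝ => t - t ^ 2 / (4 * l)) (1 - t / (2 * l)) t := by
      intro t _
      have h1 : HasDerivAt (fun t : ℝ => t ^ 2 / (4 * l)) (2 * t / (4 * l)) t := by
        simpa using ((hasDerivAt_id' t).pow 2).div_const (4 * l)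
      refine ((hasDerivAt_id' t).sub h1).congr_deriv ?_
      field_simp
      ring
    rw [intervalIntegral.integral_eq_sub_of_hasDerivAt hderiv
      ((by fun_prop : Continuous fun t : ℝ => 1 - t / (2 * l)).intervalIntegrable _ _)]
    field_simp
    ring
  · -- antiderivative `F(t) = (1 − t/(2λ)) sin(tx)/x − cos(tx)/(2λx²)`
    have hderiv : ∀ t ∈ uIcc (0 : ℝ) (2 * l),
        HasDerivAt (fun t : ℝ => (1 - t / (2 * l)) * sin (t * x) / x - cos (t * x) / (2 * l * x ^ 2))
          ((1 - t / (2 * l)) * cos (t * x)) t := by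
      intro t _
      have h1 : HasDerivAt (fun t : ℝ => 1 - t / (2 * l)) (-(1 / (2 * l))) t := by
        simpa using ((hasDerivAt_id t).div_const (2 * l)).const_sub 1
      have h2 : HasDerivAt (fun t : ℝ => sin (t * x)) (cos (t * x) * x) t := by
        simpa using ((hasDerivAt_id' t).mul_const x).sin
      have h3 : HasDerivAt (fun t : ℝ => cos (t * x)) (-sin (t * x) * x) t := by
        simpa using ((hasDerivAt_id' t).mul_const x).cos
      have h4 := ((h1.mul h2).div_const x).sub (h3.div_const (2 * l * x ^ 2))
      refine h4.congr_deriv ?_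
      field_simp
      ring
    rw [intervalIntegral.integral_eq_sub_of_hasDerivAt hderiv
      ((by fun_prop : Continuous fun t : ℝ => (1 - t / (2 * l)) * cos (t * x)).intervalIntegrable
        _ _)]
    have hlx : l * x ≠ 0 := mul_ne_zero hl.ne' hx
    rw [sinc_of_ne_zero hlx]
    simp only [zero_mul, sin_zero, mul_zero, zero_div, cos_zero, zero_sub]
    have hc : cos (2 * l * x) = 1 - 2 * sin (l * x) ^ 2 := by
      rw [show 2 * l * x = 2 * (l * x) by ring, cos_two_mul]
      linarith [sin_sq_add_cos_sq (l * x)]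
    rw [hc, div_pow]
    field_simp
    ring

/-- **Fourier identity for the Fejér kernel** (transform of the triangle function): for `λ > 0`
and real `x`, `∫_{-2λ}^{2λ} (1 − |t|/(2λ)) e^{i t x} dt = 2 λ sinc(λ x)² = K_λ(x)`
(Montgomery–Vaughan 2007, eq. (5.17)/(D.9) up to normalisation; Chandrasekharan 1968, Ch. XI §2).
[cite: MontgomeryVaughan2007, §5.1 eq. (5.17)] -/
theorem integral_triangle_mul_exp {l : ℝ} (hl : 0 < l) (x : ℝ) :
    ∫ t in (-(2 * l))..(2 * l), ((1 - |t| / (2 * l) : ℝ) : ℂ) * Complex.exp (Complex.I * t * x)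
      = ((2 * l * sinc (l * x) ^ 2 : ℝ) : ℂ) := by
  set f : ℝ → ℂ := fun t => ((1 - |t| / (2 * l) : ℝ) : ℂ) * Complex.exp (Complex.I * t * x)
    with hf_def
  have hf : Continuous f := by
    rw [hf_def]
    fun_prop
  have h1 : ∫ t in (-(2 * l))..0, f t = ∫ t in (0 : ℝ)..(2 * l), f (-t) := by
    rw [intervalIntegral.integral_comp_neg]
    simp
  have hl2 : (0 : ℝ) ≤ 2 * l := by linarith
  rw [← intervalIntegral.integral_add_adjacent_intervals (hf.intervalIntegrable _ 0)
      (hf.intervalIntegrable 0 _), h1,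
    ← intervalIntegral.integral_add
      ((by rw [hf_def]; fun_prop : Continuous fun t => f (-t)).intervalIntegrable _ _)
      (hf.intervalIntegrable _ _)]
  have h2 : EqOn (fun t => f (-t) + f t)
      (fun t => (((2 : ℝ) * ((1 - t / (2 * l)) * cos (t * x)) : ℝ) : ℂ)) (uIcc 0 (2 * l)) := by
    intro t ht
    rw [uIcc_of_le hl2] at ht
    have e1 : Complex.exp (Complex.I * (t : ℂ) * x) =
        Complex.cos ((t : ℂ) * x) + Complex.sin ((t : ℂ) * x) * Complex.I := by
      rw [← Complex.exp_mul_I]; ring_nf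
    have e2 : Complex.exp (Complex.I * ((-t : ℝ) : ℂ) * x) =
        Complex.cos ((t : ℂ) * x) - Complex.sin ((t : ℂ) * x) * Complex.I := by
      have := Complex.exp_mul_I (-((t : ℂ) * x))
      rw [Complex.cos_neg, Complex.sin_neg] at this
      push_cast
      rw [show Complex.I * -(t : ℂ) * x = -((t : ℂ) * x) * Complex.I by ring, this]
      ring
    simp only [hf_def, abs_neg, abs_of_nonneg ht.1]
    rw [e1, e2]
    push_cast
    ring
  rw [intervalIntegral.integral_congr h2, intervalIntegral.integral_ofReal,
    intervalIntegral.integral_const_mul, integral_triangle_mul_cos hl x]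
  push_cast
  ring

end Literature.NumberTheory.LFunctions.WienerIkehara

end
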